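/-
COR-CM (cell pub-hodgecm2) — ¬hJ lane, milestone M1, SECOND INSTALMENT (LEAD d2bridge-wb-9 g7, statement file `HOME/d2bridge/wb-9/nothj/M1Statement.lean`
46a03aae15048ae2, theorems M1d `eq_zero_of_exchange_on_submodule_of_multiplicityFree` and M1e `eq_iSup_of_le_of_multiplicityFree`, added 14:4xZ after the
first instalment M1a∕M1b∕M1c∕bridge was filed as ✔/pending p381208 `D2Bridge/NotHJMultiplicityFree.lean` by mukey-p10).  Pen nothj-p2 g0
(prover-pub-hodgecm2-nothj-p2-g0-0).  Pure algebra over the first instalment; `import Mathlib` + the M1 leaf; theorems only, no `sorry`.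
HC_CM is NOT proved; nothing here asserts hJ, hJ₀ or their negations.
-/
import Summits.HodgeConjecture.CorCM.D2Bridge.NotHJMultiplicityFree
import HarnessLib

/-!
# ¬hJ lane, milestone M1 (second instalment): exchange maps on a submodule; submodules are sums of components

Over the multiplicity-free semisimple setting of `D2Bridge/NotHJMultiplicityFree.lean` (`C : ι → Submodule R H` an internal direct sum of
pairwise non-isomorphic simple submodules):

* `range_le_of_multiplicityFree` — any `R`-linear map `C i → H` has range in `C i` (the common core of M1a and M1d);
* `exists_eq_of_isSimpleModule_of_multiplicityFree` — every simple submodule of `H` IS one of the `C i`;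
* `eq_iSup_of_le_of_multiplicityFree` (M1e) — every submodule `T'` is the supremum of the components `C i ≤ T'`;
* `eq_zero_of_exchange_on_submodule_of_multiplicityFree` (M1d) — an `R`-linear map `E : T' → H` defined on a SUBMODULE and exchanging a
  complementary pair `P ⊕ Q = H` on `T'` (`E (T' ∩ P) ⊆ Q`, `E (T' ∩ Q) ⊆ P`) is zero — the form the κ-construction M3 needs (`E` is only
  defined on the image of the pin's pull-back).

All folklore (Schur's lemma; isotypic components of a completely reducible module).

## References
* [Liu2021] Y. Liu, *Fourier–Jacobi cycles and arithmetic relative trace formula*, Camb. J. Math. 9 (2021), Prop. 4.13, Thm. 4.18 (2).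
* N. Jacobson, *Basic Algebra II*, §3.5.
-/

namespace Summit.HodgeConjecture.CorCM.D2Bridge.NotHJ

variable {R : Type*} [Ring R] {H : Type*} [AddCommGroup H] [Module R H] {ι : Type*} [DecidableEq ι]

/-! ## M1d ∕ M1e (LEAD's statement file, second instalment 14:4xZ): exchange maps defined on a submodule; submodules are sums of components -/

/-- **Maps out of a component land in that component** (the common core of M1a ∕ M1d): for any `R`-linear `g : C i → H` and `j ≠ i`,
`proj_j ∘ g : C i → C j` is an `R`-map between non-isomorphic simples, hence `0` (Schur), so `range g ≤ C i`. [folklore] -/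
theorem range_le_of_multiplicityFree (C : ι → Submodule R H) (hint : DirectSum.IsInternal C)
    (hs : ∀ i, IsSimpleModule R (C i)) (hni : ∀ i j, Nonempty (C i ≃ₗ[R] C j) → i = j)
    (i : ι) (g : C i →ₗ[R] H) : LinearMap.range g ≤ C i := by
  rintro _ ⟨x, rfl⟩
  set e : (DirectSum ι fun k => ↥(C k)) ≃ₗ[R] H := LinearEquiv.ofBijective (DirectSum.coeLinearMap C) hint with he
  have hcomp : ∀ j, j ≠ i → (e.symm (g x)) j = 0 := by
    intro j hj
    let f : C i →ₗ[R] C j :=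
      (DirectSum.component R ι (fun k => ↥(C k)) j) ∘ₗ (e.symm : H →ₗ[R] DirectSum ι fun k => ↥(C k)) ∘ₗ g
    haveI := hs i
    haveI := hs j
    rcases LinearMap.bijective_or_eq_zero f with hf | hf
    · exact absurd (hni i j ⟨LinearEquiv.ofBijective f hf⟩) (fun h => hj h.symm)
    · have h0 : f x = 0 := by rw [hf, LinearMap.zero_apply]
      exact h0
  have hd : e.symm (g x) = DirectSum.of (fun k => ↥(C k)) i ((e.symm (g x)) i) := by
    refine DFinsupp.ext fun j => ?_
    by_cases hj : j = i
    · subst hj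
      rw [DirectSum.of_eq_same]
    · rw [DirectSum.of_eq_of_ne _ _ _ hj, hcomp j hj]
  have hgx : g x = e (e.symm (g x)) := (e.apply_symm_apply (g x)).symm
  rw [hgx, hd, he, LinearEquiv.ofBijective_apply, DirectSum.coeLinearMap_of]
  exact Submodule.coe_mem _

/-- **A simple submodule of a multiplicity-free semisimple module IS one of the components**: some projection `S → C i` is non-zero, hence
bijective (Schur); every other projection `S → C j` is then zero (else `C i ≃ S ≃ C j`, contradicting pairwise non-isomorphy), so `S ≤ C i`,
and a non-zero submodule of the simple `C i` is `C i` (`IsAtom`). [folklore] -/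
theorem exists_eq_of_isSimpleModule_of_multiplicityFree (C : ι → Submodule R H) (hint : DirectSum.IsInternal C)
    (hs : ∀ i, IsSimpleModule R (C i)) (hni : ∀ i j, Nonempty (C i ≃ₗ[R] C j) → i = j)
    (S : Submodule R H) (hS : IsSimpleModule R S) : ∃ i, S = C i := by
  set e : (DirectSum ι fun k => ↥(C k)) ≃ₗ[R] H := LinearEquiv.ofBijective (DirectSum.coeLinearMap C) hint with he
  have hSat : IsAtom S := isSimpleModule_iff_isAtom.1 hS
  -- a non-zero element of `S` and a non-zero component of it
  obtain ⟨x, hxS, hx0⟩ := (Submodule.ne_bot_iff S).1 hSat.1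
  have hex : ∃ i, (e.symm x) i ≠ 0 := by
    by_contra h
    have h' : ∀ j, (e.symm x) j = 0 := fun j => not_not.1 fun hj => h ⟨j, hj⟩
    have : e.symm x = 0 := DFinsupp.ext fun j => by rw [h' j]; rfl
    exact hx0 (by simpa using congrArg e this)
  obtain ⟨i, hi⟩ := hex
  -- the projections `S → C j`
  let f : ∀ j, S →ₗ[R] C j := fun j =>
    (DirectSum.component R ι (fun k => ↥(C k)) j) ∘ₗ (e.symm : H →ₗ[R] DirectSum ι fun k => ↥(C k)) ∘ₗ S.subtype
  have hf : ∀ j (y : S), (f j y : C j) = (e.symm (y : H)) j := fun j y => rfl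
  haveI := hS
  haveI := fun j => hs j
  have hfi : Function.Bijective (f i) := by
    refine LinearMap.bijective_of_ne_zero (fun h0 => hi ?_)
    rw [← hf i ⟨x, hxS⟩, h0, LinearMap.zero_apply]
  have hfj : ∀ j, j ≠ i → f j = 0 := by
    intro j hj
    rcases LinearMap.bijective_or_eq_zero (f j) with hb | hb
    · exact absurd (hni i j ⟨(LinearEquiv.ofBijective (f i) hfi).symm.trans (LinearEquiv.ofBijective (f j) hb)⟩) (fun h => hj h.symm)
    · exact hb
  -- hence `S ≤ C i`
  have hle : S ≤ C i := by
    intro y hy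
    have hd : e.symm y = DirectSum.of (fun k => ↥(C k)) i ((e.symm y) i) := by
      refine DFinsupp.ext fun j => ?_
      by_cases hj : j = i
      · subst hj
        rw [DirectSum.of_eq_same]
      · rw [DirectSum.of_eq_of_ne _ _ _ hj, ← hf j ⟨y, hy⟩, hfj j hj, LinearMap.zero_apply]
    have hy' : y = e (e.symm y) := (e.apply_symm_apply y).symm
    rw [hy', hd, he, LinearEquiv.ofBijective_apply, DirectSum.coeLinearMap_of]
    exact Submodule.coe_mem _
  -- and `C i` is an atom
  have hCat : IsAtom (C i) := isSimpleModule_iff_isAtom.1 (hs i)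
  rcases hCat.le_iff.1 hle with h | h
  · exact absurd h hSat.1
  · exact ⟨i, h⟩

/-- **M1e — submodules of a multiplicity-free semisimple module are sums of components** (used by M1d and by M2c): `H` is semisimple
(generated by the simple `C i`), so `T'` is the supremum of the simple submodules below it (`IsSemisimpleModule.sSup_simples_le`), and each
of those is some `C i ≤ T'` (`exists_eq_of_isSimpleModule_of_multiplicityFree`). [folklore] -/
theorem eq_iSup_of_le_of_multiplicityFree (C : ι → Submodule R H) (hint : DirectSum.IsInternal C)
    (hs : ∀ i, IsSimpleModule R (C i)) (hni : ∀ i j, Nonempty (C i ≃ₗ[R] C j) → i = j)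
    (T' : Submodule R H) : T' = ⨆ i ∈ {i | C i ≤ T'}, C i := by
  haveI : IsSemisimpleModule R H :=
    isSemisimpleModule_of_isSemisimpleModule_submodule' (p := C)
      (fun i => by haveI := hs i; infer_instance) hint.submodule_iSup_eq_top
  apply le_antisymm
  · calc T' = sSup {m : Submodule R H | IsSimpleModule R m ∧ m ≤ T'} := (IsSemisimpleModule.sSup_simples_le T').symm
      _ ≤ ⨆ i ∈ {i | C i ≤ T'}, C i := by
        refine sSup_le fun m hm => ?_
        obtain ⟨hm, hmT⟩ := hm
        obtain ⟨i, rfl⟩ := exists_eq_of_isSimpleModule_of_multiplicityFree C hint hs hni m hm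
        exact le_iSup₂_of_le i (show i ∈ {i | C i ≤ T'} from hmT) le_rfl
  · exact iSup₂_le fun i hi => hi

/-- **M1d — the obstruction for a map defined on a SUBMODULE** (the form M3-κ needs: `E` is only defined on the image `T′` of the pin's
pull-back).  If `E : T′ →ₗ[R] H` sends `T′ ∩ P` into `Q` and `T′ ∩ Q` into `P`, then `E = 0`: `T′` is the sum of the components `C i ≤ T′`
(M1e); on such a `C i`, `E` (precomposed with the inclusion) has range in `C i` (`range_le_of_multiplicityFree`) and `C i ≤ P` or `C i ≤ Q`
(M1b), so `E (C i) ≤ C i ⊓ Q ≤ P ⊓ Q = ⊥` (resp. symmetrically); hence `E` vanishes on every `C i ≤ T′` and on `T′`. [folklore] -/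
theorem eq_zero_of_exchange_on_submodule_of_multiplicityFree (C : ι → Submodule R H) (hint : DirectSum.IsInternal C)
    (hs : ∀ i, IsSimpleModule R (C i)) (hni : ∀ i j, Nonempty (C i ≃ₗ[R] C j) → i = j)
    {P Q : Submodule R H} (hPQ : IsCompl P Q) (T' : Submodule R H) (E : T' →ₗ[R] H)
    (hEP : ∀ x : T', (x : H) ∈ P → E x ∈ Q) (hEQ : ∀ x : T', (x : H) ∈ Q → E x ∈ P) : E = 0 := by
  -- `E` vanishes on each component contained in `T'`
  have hEC : ∀ (i : ι) (hi : C i ≤ T') (x : H) (hx : x ∈ C i), E ⟨x, hi hx⟩ = 0 := by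
    intro i hi x hx
    have hself : E ⟨x, hi hx⟩ ∈ C i :=
      range_le_of_multiplicityFree C hint hs hni i (E ∘ₗ Submodule.inclusion hi) ⟨⟨x, hx⟩, rfl⟩
    rcases le_or_le_of_isCompl_of_multiplicityFree C hint hs hni hPQ i with hP | hQ
    · exact (Submodule.disjoint_def.1 hPQ.disjoint) _ (hP hself) (hEP _ (hP hx))
    · exact (Submodule.disjoint_def.1 hPQ.disjoint) _ (hEQ _ (hQ hx)) (hQ hself)
  -- `T'` is the sum of those components
  set S : Set ι := {i | C i ≤ T'} with hS
  have hle : (⨆ i ∈ S, C i) ≤ T' := iSup₂_le fun i hi => hi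
  have key : ∀ (y : H) (hy : y ∈ ⨆ i ∈ S, C i), E ⟨y, hle hy⟩ = 0 := by
    intro y hy
    refine Submodule.iSup_induction' (fun i => ⨆ (_ : i ∈ S), C i) (motive := fun z hz => E ⟨z, hle hz⟩ = 0)
      ?_ ?_ ?_ hy
    · intro i z hz
      by_cases hi : i ∈ S
      · have hCi : (⨆ (_ : i ∈ S), C i) ≤ C i := (iSup_pos hi).le
        exact hEC i hi z (hCi hz)
      · have hbot : (⨆ (_ : i ∈ S), C i) ≤ (⊥ : Submodule R H) := (iSup_neg hi).le
        have hz0 : z = 0 := (Submodule.mem_bot R).1 (hbot hz)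
        subst hz0
        exact map_zero E
    · exact map_zero E
    · intro z w hz hw hEz hEw
      have hadd : (⟨z + w, hle (Submodule.add_mem _ hz hw)⟩ : T') = ⟨z, hle hz⟩ + ⟨w, hle hw⟩ := rfl
      rw [hadd, map_add, hEz, hEw, add_zero]
  refine LinearMap.ext fun x => ?_
  have hx : (x : H) ∈ ⨆ i ∈ S, C i := by
    rw [hS, ← eq_iSup_of_le_of_multiplicityFree C hint hs hni T']
    exact x.2
  rw [LinearMap.zero_apply, ← key x hx]

end Summit.HodgeConjecture.CorCM.D2Bridge.NotHJ
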